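import Summits.AtomisticToContinuum.BoseEinsteinCondensation.Theorems.BECRichardsonGaudinRichardsonAnchorBECBornEventuallyAux
import HarnessLib

/-!
# Crux `RichardsonAnchorBEC` (stmt-AtomisticToContinuum-14805), line `registered` — the Born upper bound `stub_bornTrialState`

For `γ, Λ, ε > 0` there is `ρ₀ > 0` such that for `ρ ∈ (0, ρ₀)` and all large `N = n+2`:
`inf_Φ E_Δ(Φ) ≤ e_ref + εργN`, `e_ref = bornEnergy = γρN/(2(1+γJ_M))` — the UPPER half of the crux line (stub U of the birth
skeleton), realised by the number-conserving, pair-number-windowed, infrared-cut Born trial state (`bornTrialPoly`): choices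
`r = min(Λ/8π, 8π²ε/65γ)`, `2^{−T₁} ≤ 2ε/5`, `R = ⌊rL⌋`, `Θ = L²/(4π²(R+1)²)`, `J₁ = ⌈2m⌉ + T₁`, `ρ₀(γ, Λ, ε)`, and the lattice
bookkeeping `stub_windowLattice` make each remainder of `stub_bornFixed` at most `εργN/5`.
-/

noncomputable section

namespace Summit.AtomisticToContinuum.BoseEinsteinCondensation.Cruxes.RichardsonAnchorBEC.Birth

open MeasureTheory Filter
open scoped ENNReal NNReal
open Literature.MathematicalPhysics.QuantumManyBody.BoseGas
open Summit.AtomisticToContinuum.BoseEinsteinCondensation.Theses.BECRichardsonGaudin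
open Summit.AtomisticToContinuum.BoseEinsteinCondensation.Cruxes.PeriodicIRBound.LinearPhFloorWagner.WF (normSq innerRe)

/-- **The Born upper bound** (registered `stub_bornTrialState`, stub U of the line): `∀ γ Λ ε > 0 ∃ ρ₀ ∀ ρ ∈ (0,ρ₀) ∀ᶠ n,
inf_Φ E_Δ(Φ) ≤ bornEnergy + εργN` — eventual bookkeeping around `stub_bornFixed` (blueprint U6b). [folklore] -/
theorem stub_bornTrialState :
    ∀ γ Λ ε : ℝ, 0 < γ → 0 < Λ → 0 < ε → ∃ ρ₀ : ℝ, 0 < ρ₀ ∧ ∀ ρ : ℝ, 0 < ρ → ρ < ρ₀ →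
      ∀ᶠ n : ℕ in Filter.atTop,
        (⨅ Φ, anchorE γ (2 * ρ * γ) ρ n Λ Φ) ≤
          ENNReal.ofReal (bornEnergy γ ρ n Λ) + ENNReal.ofReal (ε * (ρ * γ) * ((n + 2 : ℕ) : ℝ)) := by
  intro γ Λ ε hγ hΛ hε
  have hπ := Real.pi_pos
  -- the truncation depth `T₁`, the infrared scale `r`, the constant `C_m` and the budgets `κ₁, κ₂`
  obtain ⟨T₁, hT₁⟩ := exists_pow_lt_of_lt_one (show (0 : ℝ) < 2 * ε / 5 by positivity)
    (show (1 / 2 : ℝ) < 1 by norm_num)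
  obtain ⟨r, hr, hrΛ, hrε⟩ : ∃ r : ℝ, 0 < r ∧ r ≤ Λ / (8 * Real.pi) ∧ r ≤ 8 * Real.pi ^ 2 * ε / (65 * γ) :=
    ⟨min (Λ / (8 * Real.pi)) (8 * Real.pi ^ 2 * ε / (65 * γ)), lt_min (by positivity) (by positivity),
      min_le_left _ _, min_le_right _ _⟩
  obtain ⟨Cm, hCm⟩ : ∃ Cm : ℝ, Cm = 13 * γ ^ 2 / (32 * Real.pi ^ 4 * r) := ⟨_, rfl⟩
  have hCm0 : 0 < Cm := by rw [hCm]; positivity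
  obtain ⟨κ₁, hκ₁0, hκ₁a, hκ₁b⟩ : ∃ κ : ℝ, 0 < κ ∧ κ ≤ 1 / 4 ∧ κ ≤ 2 * ε / 5 :=
    ⟨min (1 / 4) (2 * ε / 5), lt_min (by norm_num) (by positivity), min_le_left _ _, min_le_right _ _⟩
  obtain ⟨κ₂, hκ₂0, hκ₂a, hκ₂b⟩ : ∃ κ : ℝ, 0 < κ ∧ κ ≤ 1 / 2 ∧ κ ≤ ε / 15 :=
    ⟨min (1 / 2) (ε / 15), lt_min (by norm_num) (by positivity), min_le_left _ _, min_le_right _ _⟩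
  -- the density threshold `ρ₀`
  refine ⟨min (min 1 (ε / (20 * Cm))) (min (1 / (8 * Cm)) (min (κ₁ * r ^ 3 / (6 * Cm))
      (2 * Real.pi ^ 2 * r ^ 2 * κ₂ / (γ * Cm)))),
    lt_min (lt_min one_pos (by positivity)) (lt_min (by positivity) (lt_min (by positivity) (by positivity))),
    fun ρ hρ hρ₀ => ?_⟩
  have hρ1 : ρ ≤ 1 := hρ₀.le.trans ((min_le_left _ _).trans (min_le_left _ _))
  have hρa' : ρ ≤ ε / (20 * Cm) := hρ₀.le.trans ((min_le_left _ _).trans (min_le_right _ _))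
  have hρb' : ρ ≤ 1 / (8 * Cm) := hρ₀.le.trans ((min_le_right _ _).trans (min_le_left _ _))
  have hρc' : ρ ≤ κ₁ * r ^ 3 / (6 * Cm) :=
    hρ₀.le.trans ((min_le_right _ _).trans ((min_le_right _ _).trans (min_le_left _ _)))
  have hρd' : ρ ≤ 2 * Real.pi ^ 2 * r ^ 2 * κ₂ / (γ * Cm) :=
    hρ₀.le.trans ((min_le_right _ _).trans ((min_le_right _ _).trans (min_le_right _ _)))
  have hρa : 4 * Cm * ρ ≤ ε / 5 := by
    rw [le_div_iff₀ (by positivity)] at hρa'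
    linarith only [hρa']
  have hρb : 4 * Cm * ρ ≤ 1 / 2 := by
    rw [le_div_iff₀ (by positivity)] at hρb'
    linarith only [hρb']
  have hρc : 3 * (2 * Cm * ρ) / r ^ 3 ≤ κ₁ := by
    rw [le_div_iff₀ (by positivity)] at hρc'
    rw [div_le_iff₀ (by positivity)]
    linarith only [hρc']
  have hρd : γ * (2 * Cm * ρ) / (4 * Real.pi ^ 2 * r ^ 2) ≤ κ₂ := by
    rw [le_div_iff₀ (by positivity)] at hρd'
    rw [div_le_iff₀ (by positivity)]
    linarith only [hρd']
  -- the particle-number threshold: `L ≥ 4π/Λ` and three lower bounds on `N = n + 2`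
  filter_upwards [be_eventually_L hρ (4 * Real.pi / Λ),
    be_eventually_N (3 * (1 + T₁) * ρ / (r ^ 3 * κ₁)),
    be_eventually_N (γ * (1 + T₁) * ρ / (4 * Real.pi ^ 2 * r ^ 2 * κ₂)),
    be_eventually_N (2 * (4 + 2 * (T₁ : ℝ)))] with n hL1 hN2 hN3 hN4
  -- the Born parameters at this `N` and the fixed-parameter bound (used once)
  obtain ⟨hJN, hTJ, h2m, hp, hu, hΘ, hbig⟩ :=
    be_params (N := n + 2) hγ hΛ hρ hρ1 hr hrΛ hrε hCm hκ₁0 hκ₁a hκ₁b hκ₂0 hκ₂a hκ₂b hT₁.le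
      hρa hρb hρc hρd (sideLength_succ_succ_pos hρ n) (sideLength_pow_three hρ (n + 2)) hL1 hN2 hN3 hN4
      rfl rfl rfl rfl
  refine (stub_bornFixed γ ρ Λ _ n _ _ T₁ hγ hρ (by positivity) hJN hTJ h2m hp hu hΘ).trans ?_
  rw [← ENNReal.ofReal_add (bornEnergy_nonneg hγ.le hρ n Λ) (by positivity)]
  exact ENNReal.ofReal_le_ofReal hbig

/-! ## Proved glue (no `sorry` below this line) -/

end Summit.AtomisticToContinuum.BoseEinsteinCondensation.Cruxes.RichardsonAnchorBEC.Birth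

end
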